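import Literature.AlgebraicTopology.Homotopy.SerreFibrationSkeleta
import Literature.AlgebraicTopology.SingularHomology.CollapseMap
import HarnessLib

/-!
# The Serre exact sequence `Hₙ(E, F) ≅ Hₙ(X, b₀)` in the stable range `n < m + r`

Topic `Literature/AlgebraicTopology/Homotopy`. J.-P. Serre, *Homologie singulière des espaces
fibrés. Applications*, Ann. of Math. 54 (1951), Ch. III §4 Prop. 5 and Cor. 1: for a (Serre)
fibre space `p : E → X` over an `(m-1)`-connected base with `(r-1)`-connected fibre `F`,
`p_* : Hᵢ(E, F) → Hᵢ(X, b₀)` is an isomorphism for `i < m + r` and onto for `i = m + r`,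
whence the exact sequence `Hᵢ(F) → Hᵢ(E) → Hᵢ(X) → Hᵢ₋₁(F) → ⋯` for `i < m + r` (A. Hatcher,
*Algebraic Topology* (2002), spectral-sequences chapter, the "Serre exact sequence"; E. H. Spanier,
*Algebraic Topology* (1981), Ch. 9, Sec. 3). Here from the comparison
theorem of `SerreFibrationSkeleta.lean` applied to `p` as a fibrewise map from `p` to the
identity fibration of `X`, for a Hausdorff CW base with one `0`-cell `b₀` and no cells of
dimension `1, …, m-1` (the CW form of `(m-1)`-connectedness) and fibres that are ALL
path-connected with `H_k = 0` for `0 < k < r` (the homological form of `(r-1)`-connectedness):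

* `IsSerreFibration.id` — the identity is a Serre fibration;
* `SerreExact.isIso_map` — **`p_* : Hₙ(E, p⁻¹b₀; R) ≅ Hₙ(X, b₀; R)` for `n < m + r`**;
* `SerreExact.epi_map` — `p_*` is onto for `n ≤ m + r`.

Everything is proved; no named facts.

## References

* J.-P. Serre, *Homologie singulière des espaces fibrés. Applications*, Ann. of Math. (2) 54
  (1951), 425–505, Ch. III §4, Prop. 5, Cor. 1. [Serre1951]
* E. H. Spanier, *Algebraic Topology*, Springer (1981), Ch. 9, Sec. 3, Thm. 1–3. [Spanier1981]
* A. Hatcher, *Algebraic Topology*, CUP (2002), §4.2 p. 376; spectral-sequences chapter. [HatcherAT2002]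
-/

noncomputable section

open Set Function Metric unitInterval CategoryTheory CategoryTheory.Limits
open scoped Topology unitInterval Topology.Homotopy
open Literature.AlgebraicTopology.SingularHomology

namespace Literature.AlgebraicTopology.Homotopy

universe u uR

/-- **The identity map is a Serre fibration.** [cite: HatcherAT2002, §4.2 p. 376] -/
theorem IsSerreFibration.id {X : Type u} [TopologicalSpace X] : IsSerreFibration (fun x : X => x) :=
  ⟨continuous_id, fun _ K _ _ hgK => ⟨K, fun _ => rfl, fun z hz => (hgK z hz).symm⟩⟩

namespace SerreExact

open _root_.Topology RelCWComplex

variable (R : Type uR) [CommRing R]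
variable {X : Type u} [TopologicalSpace X] [T2Space X] [CWComplex (univ : Set X)]
variable {E : Type u} [TopologicalSpace E] {p : E → X}

/-- `p` as a continuous map. [folklore] -/
abbrev proj (hp : IsSerreFibration p) : C(E, X) := ⟨p, hp.continuous⟩

omit [T2Space X] [CWComplex (univ : Set X)] in
/-- `p` is a fibrewise map from `p` to the identity fibration. [folklore] -/
theorem proj_fibrewise (hp : IsSerreFibration p) : ∀ e, (fun x : X => x) (proj hp e) = p e := fun _ => rfl

omit [T2Space X] [CWComplex (univ : Set X)] in
/-- **The fibre condition of the comparison theorem for `f = p`**: if every fibre is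
path-connected and has `H_k = 0` for `0 < k < r` (`r ≥ 1`), then on every fibre
`p_* : H_k(p⁻¹x) → H_k({x})` is an isomorphism for `k < r` and onto for `k = r`.
[cite: Serre1951, Ch. III §4 Prop. 5 (hypotheses)] -/
theorem fibre_condition (hp : IsSerreFibration p) {r : ℕ} (hr : 0 < r)
    (hconn : ∀ x : X, PathConnectedSpace ↥(p ⁻¹' {x}))
    (hF : ∀ (x : X) (k : ℕ), 0 < k → k < r → IsZero (singularHomology R R ↥(p ⁻¹' {x}) k)) (x : X) :
    (∀ k, k < r → IsIso (singularHomology.map R R (SerreCell.restrictPreimage (p' := fun y : X => y) (proj hp) (proj_fibrewise hp) {x}) k)) ∧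
      Epi (singularHomology.map R R (SerreCell.restrictPreimage (p' := fun y : X => y) (proj hp) (proj_fibrewise hp) {x}) r) := by
  haveI := hconn x
  haveI : PathConnectedSpace ↥((fun y : X => y) ⁻¹' ({x} : Set X)) :=
    isPathConnected_iff_pathConnectedSpace.1 (isPathConnected_singleton x)
  haveI : Subsingleton ↥((fun y : X => y) ⁻¹' ({x} : Set X)) := ⟨fun a b => Subtype.ext (a.2.trans b.2.symm)⟩
  have hpt : ∀ k, 0 < k → IsZero (singularHomology R R ↥((fun y : X => y) ⁻¹' ({x} : Set X)) k) :=
    fun k hk => isZero_singularHomology_of_subsingleton R R (Nat.pos_iff_ne_zero.1 hk)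
  refine ⟨fun k hk => ?_, (hpt r hr).epi _⟩
  rcases Nat.eq_zero_or_pos k with rfl | hk0
  · exact singularHomology.isIso_map_zero_of_pathConnectedSpace R R _
  · exact isIso_of_source_target_iso_zero _ (hF x k hk0 hk).isoZero (hpt k hk0).isoZero

/-- **The Serre exact sequence, isomorphism range** (Serre 1951, III §4 Prop. 5 / Cor. 1): for a
Serre fibration over a Hausdorff CW complex with one `0`-cell `b₀` and no cells of dimension
`1, …, m-1`, all of whose fibres are path-connected with `H_k(F; R) = 0` for `0 < k < r`
(`r ≥ 1`), `p_* : Hₙ(E, p⁻¹b₀; R) → Hₙ(X, b₀; R)` is an isomorphism for `n < m + r`.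
[cite: Serre1951, Ch. III §4 Prop. 5, Cor. 1] -/
theorem isIso_map (hp : IsSerreFibration p) {b₀ : X} (h0 : ∀ x : X, x ∈ SerreSkeleta.skel X 0 ↔ x = b₀)
    {m r : ℕ} (hr : 0 < r) (hcells : ∀ k, 1 ≤ k → k < m → IsEmpty (cell (univ : Set X) k))
    (hconn : ∀ x : X, PathConnectedSpace ↥(p ⁻¹' {x}))
    (hF : ∀ (x : X) (k : ℕ), 0 < k → k < r → IsZero (singularHomology R R ↥(p ⁻¹' {x}) k))
    {n : ℕ} (hn : n < m + r) :
    IsIso (relativeSingularHomology.map R R (proj hp) (Set.mapsTo_preimage p ({b₀} : Set X)) n) :=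
  SerreSkeleta.isIso_map R (p' := fun y : X => y) (proj hp) (proj_fibrewise hp) hcells
    (fibre_condition R hp hr hconn hF) b₀ h0 hp IsSerreFibration.id hn

/-- **The Serre exact sequence, surjectivity at the edge** `n ≤ m + r`.
[cite: Serre1951, Ch. III §4 Prop. 5, Cor. 1] -/
theorem epi_map (hp : IsSerreFibration p) {b₀ : X} (h0 : ∀ x : X, x ∈ SerreSkeleta.skel X 0 ↔ x = b₀)
    {m r : ℕ} (hr : 0 < r) (hcells : ∀ k, 1 ≤ k → k < m → IsEmpty (cell (univ : Set X) k))
    (hconn : ∀ x : X, PathConnectedSpace ↥(p ⁻¹' {x}))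
    (hF : ∀ (x : X) (k : ℕ), 0 < k → k < r → IsZero (singularHomology R R ↥(p ⁻¹' {x}) k))
    {n : ℕ} (hn : n ≤ m + r) :
    Epi (relativeSingularHomology.map R R (proj hp) (Set.mapsTo_preimage p ({b₀} : Set X)) n) :=
  SerreSkeleta.epi_map R (p' := fun y : X => y) (proj hp) (proj_fibrewise hp) hcells
    (fibre_condition R hp hr hconn hF) b₀ h0 hp IsSerreFibration.id hn


/-- **The Serre exact sequence, isomorphism range, for a base whose low skeleton is weakly
contractible** (mapping telescopes of CW complexes): `b₀ ∈ Xˢ⁰`, `{b₀} ↪ Xˢ⁰` a weak homotopy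
equivalence, `s₀ + 1 ≥ m`, all fibres path-connected with `H_k(F; R) = 0` for `0 < k < r`
(`r ≥ 1`): `p_*` is an isomorphism for `n < m + r`. [cite: Serre1951, Ch. III §4 Prop. 5, Cor. 1] -/
theorem isIso_map_of_isWeakHomotopyEquiv (hp : IsSerreFibration p) {b₀ : X} (s₀ : ℕ) {m r : ℕ} (hms : m ≤ s₀ + 1)
    (hb : b₀ ∈ SerreSkeleta.skel X s₀) (hw : IsWeakHomotopyEquiv (subsetInclusion (singleton_subset_iff.2 hb)))
    (hr : 0 < r) (hconn : ∀ x : X, PathConnectedSpace ↥(p ⁻¹' {x}))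
    (hF : ∀ (x : X) (k : ℕ), 0 < k → k < r → IsZero (singularHomology R R ↥(p ⁻¹' {x}) k))
    {n : ℕ} (hn : n < m + r) :
    IsIso (relativeSingularHomology.map R R (proj hp) (Set.mapsTo_preimage p ({b₀} : Set X)) n) :=
  SerreSkeleta.isIso_map_of_isWeakHomotopyEquiv R (p' := fun y : X => y) (proj hp) (proj_fibrewise hp)
    (fibre_condition R hp hr hconn hF) b₀ hp IsSerreFibration.id s₀ hms hb hw hn

/-- **… and surjectivity at the edge** `n ≤ m + r`. [cite: Serre1951, Ch. III §4 Prop. 5, Cor. 1] -/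
theorem epi_map_of_isWeakHomotopyEquiv (hp : IsSerreFibration p) {b₀ : X} (s₀ : ℕ) {m r : ℕ} (hms : m ≤ s₀ + 1)
    (hb : b₀ ∈ SerreSkeleta.skel X s₀) (hw : IsWeakHomotopyEquiv (subsetInclusion (singleton_subset_iff.2 hb)))
    (hr : 0 < r) (hconn : ∀ x : X, PathConnectedSpace ↥(p ⁻¹' {x}))
    (hF : ∀ (x : X) (k : ℕ), 0 < k → k < r → IsZero (singularHomology R R ↥(p ⁻¹' {x}) k))
    {n : ℕ} (hn : n ≤ m + r) :
    Epi (relativeSingularHomology.map R R (proj hp) (Set.mapsTo_preimage p ({b₀} : Set X)) n) :=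
  SerreSkeleta.epi_map_of_isWeakHomotopyEquiv R (p' := fun y : X => y) (proj hp) (proj_fibrewise hp)
    (fibre_condition R hp hr hconn hF) b₀ hp IsSerreFibration.id s₀ hms hb hw hn

end SerreExact

end Literature.AlgebraicTopology.Homotopy

end
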